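import Summits.CriticalPhenomena.Ising3DConformalLimit.Theses.SubPtolemyInterlacing
import Literature.Probability.LatticeModels.GHSInequality
import Literature.Probability.LatticeModels.CriticalUrsellFourSign
import Literature.Probability.LatticeModels.CriticalAxisRatioRegularity
import HarnessLib

/-!
# Line `Sketch` for the crux `SubPtolemyInterlacing.Interlacing` (stmt-CriticalPhenomena-15702) — stub `stub_ghsPivot`

The GHS floor with a pivot spin for the critical 3D Ising state.  Conditioning the zero-field
ferromagnet (free boundary condition, `β ≥ 0`) on `σ_p = +1` — equivalently, adding a one-site field `κ`
at `p` and letting `κ → +∞` — produces a system with nonnegative pair couplings and a nonnegative field,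
in which the Griffiths–Hurst–Sherman inequality `u₃(a,b,c) ≤ 0` holds (Griffiths–Hurst–Sherman 1970;
Lebowitz 1974, eq. (1.8); Aizenman, *Geometric analysis of Ising models III* (2025), §11 eq. (GHS)).
Read back through `⟨σ_A⟩^{(σ_p=+)} = ⟨σ_p σ_A⟩` (`|A|` odd) and `⟨σ_A⟩^{(σ_p=+)} = ⟨σ_A⟩` (`|A|` even)
it is the four-spin inequality

  `⟨σ_pσ_aσ_bσ_c⟩ ≤ G_pa G_bc + G_pb G_ac + G_pc G_ab - 2 G_pa G_pb G_pc`,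

i.e. `U₄(p,a,b,c) ≤ -2 G_pa G_pb G_pc`.  Part A proves it in every finite volume on any locally finite
graph (unnormalised form `ghsPivot_gksSum_le`, normalised form `ghsPivot_free_le`), from the tree's
`ghs_gksSum`; Part B passes to the critical state `criticalCorr 3` along the free boxes at `β_c(3)`
(`criticalCorr_wellDefined_holds`) and closes the inequality in the limit.

Helper file of the line `Sketch` (lead skeleton `Cruxes/Interlacing/Lines/Sketch.lean`): proves the registered
stub `stub_ghsPivot` verbatim (name + signature). No definitions, no named facts, no sorry.
-/

noncomputable section

namespace Summit.CriticalPhenomena.Ising3DConformalLimit.Cruxes.Interlacing.Sketch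

open Filter MeasureTheory
open scoped symmDiff Topology
open Literature.Probability.LatticeModels Literature.Probability.Percolation

/-! ### Part A — GHS with a pivot spin on any locally finite graph (free b.c., zero field)

The tilted couplings are written inline as
`Sum.elim (fun e => gksCoupling G Λ β 0 .free (.inl e)) (fun x => if x = p then κ else 0)`:
the free zero-field pair couplings plus the field `κ` at the single site `p`. -/

namespace GHSPivot

variable {V : Type*} [DecidableEq V] (G : SimpleGraph V) [G.LocallyFinite]

/-- The tilted couplings (free zero-field pair couplings plus a field `κ ≥ 0` at `p`) are nonnegative
when `β ≥ 0`. -/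
theorem ghsPivot_coupling_nonneg {Λ : Finset V} {β κ : ℝ} (hβ : 0 ≤ β) (hκ : 0 ≤ κ) (p : V) :
    ∀ i ∈ isingIdx G Λ,
      0 ≤ Sum.elim (fun e => gksCoupling G Λ β 0 .free (.inl e)) (fun x => if x = p then κ else 0) i := by
  intro i hi
  cases i with
  | inl e => exact gksCoupling_nonneg G hβ le_rfl (Or.inl rfl) (.inl e) hi
  | inr x => simp only [Sum.elim_inr]; split_ifs <;> [exact hκ; exact le_rfl]

/-- The tilted Hamiltonian is the free zero-field one plus `κ σ_p` (`p ∈ Λ`). -/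
theorem ghsPivot_hamiltonian (Λ : Finset V) (β κ : ℝ) {p : V} (hp : p ∈ Λ) (τ : SpinConfig ↥Λ) :
    gksHamiltonian (isingIdx G Λ)
        (Sum.elim (fun e => gksCoupling G Λ β 0 .free (.inl e)) (fun x => if x = p then κ else 0))
        (isingSupp Λ) τ =
      gksHamiltonian (isingIdx G Λ) (gksCoupling G Λ β 0 .free) (isingSupp Λ) τ +
        κ * spinAt p (glue Λ τ .free) := by
  simp only [gksHamiltonian, isingIdx, Finset.sum_disjSum, Sum.elim_inl, Sum.elim_inr]
  have hS0 : ∑ x ∈ Λ, gksCoupling G Λ β 0 .free (.inr x) * spinProduct (isingSupp Λ (.inr x)) τ = 0 := by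
    refine Finset.sum_eq_zero fun x _ => ?_
    simp [gksCoupling]
  have hS : ∑ x ∈ Λ, (if x = p then κ else 0) * spinProduct (isingSupp Λ (.inr x)) τ =
      κ * spinAt p (glue Λ τ .free) := by
    rw [Finset.sum_eq_single p]
    · rw [if_pos rfl, spinProduct_isingSupp_inr τ .free hp]
    · intro x _ hxp
      simp [hxp]
    · intro hnp; exact absurd hp hnp
  rw [hS, hS0, add_zero]

/-- The tilted weight: `w_κ(τ) = w₀(τ) · (cosh κ + σ_p sinh κ)`. -/
theorem ghsPivot_weight (Λ : Finset V) (β κ : ℝ) {p : V} (hp : p ∈ Λ) (τ : SpinConfig ↥Λ) :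
    gksWeight (isingIdx G Λ)
        (Sum.elim (fun e => gksCoupling G Λ β 0 .free (.inl e)) (fun x => if x = p then κ else 0))
        (isingSupp Λ) τ =
      gksWeight (isingIdx G Λ) (gksCoupling G Λ β 0 .free) (isingSupp Λ) τ *
        (Real.cosh κ + spinAt p (glue Λ τ .free) * Real.sinh κ) := by
  rw [gksWeight, gksWeight, ghsPivot_hamiltonian G Λ β κ hp, Real.exp_add,
    exp_mul_eq_cosh_add_mul_sinh κ (spinAt_eq_one_or_eq_neg_one p _)]

/-- Unnormalised expectations of the tilted system: `Σ_κ(g) = cosh κ · Σ₀(g) + sinh κ · Σ₀(g σ_p)`. -/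
theorem ghsPivot_sum (Λ : Finset V) (β κ : ℝ) {p : V} (hp : p ∈ Λ) (g : SpinConfig ↥Λ → ℝ) :
    gksSum (isingIdx G Λ)
        (Sum.elim (fun e => gksCoupling G Λ β 0 .free (.inl e)) (fun x => if x = p then κ else 0))
        (isingSupp Λ) g =
      Real.cosh κ * gksSum (isingIdx G Λ) (gksCoupling G Λ β 0 .free) (isingSupp Λ) g +
        Real.sinh κ * gksSum (isingIdx G Λ) (gksCoupling G Λ β 0 .free) (isingSupp Λ)
          (fun τ => g τ * spinAt p (glue Λ τ .free)) := by
  simp only [gksSum, Finset.mul_sum, ← Finset.sum_add_distrib]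
  refine Finset.sum_congr rfl fun τ _ => ?_
  rw [ghsPivot_weight G Λ β κ hp]
  ring

/-- Zero-field free sums of flip-odd functions vanish (spin-flip symmetry `τ ↦ -τ`). -/
theorem ghsPivot_sum_eq_zero_of_odd (Λ : Finset V) (β : ℝ) (g : SpinConfig ↥Λ → ℝ)
    (hg : ∀ τ, g (-τ) = -g τ) :
    gksSum (isingIdx G Λ) (gksCoupling G Λ β 0 .free) (isingSupp Λ) g = 0 := by
  have hw : ∀ τ : SpinConfig ↥Λ, gksWeight (isingIdx G Λ) (gksCoupling G Λ β 0 .free) (isingSupp Λ) (-τ) =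
      gksWeight (isingIdx G Λ) (gksCoupling G Λ β 0 .free) (isingSupp Λ) τ := by
    intro τ
    rw [← isingWeight_eq_gksWeight, ← isingWeight_eq_gksWeight]
    simpa using isingWeight_neg_flip G Λ β 0 .free τ
  have hsum : gksSum (isingIdx G Λ) (gksCoupling G Λ β 0 .free) (isingSupp Λ) g =
      -gksSum (isingIdx G Λ) (gksCoupling G Λ β 0 .free) (isingSupp Λ) g := by
    conv_lhs => rw [gksSum, ← Fintype.sum_equiv (Equiv.neg _) _ _ (fun τ => rfl)]
    simp only [Equiv.neg_apply, gksSum, ← Finset.sum_neg_distrib]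
    refine Finset.sum_congr rfl fun τ _ => ?_
    rw [hg, hw]
    ring
  linarith

/-- **GHS with a pivot spin (free b.c., zero field), unnormalised.** With `Σ(g) = Z⟨g⟩` the free
zero-field sums and `σp τ := spinAt p (glue Λ τ .free)` (`p ∈ Λ`, `β ≥ 0`),
`Z² Σ(σ_aσ_bσ_c σp) - Z (Σ(σ_aσ_b)Σ(σ_c σp) + Σ(σ_aσ_c)Σ(σ_b σp) + Σ(σ_bσ_c)Σ(σ_a σp))
  + 2 Σ(σ_a σp)Σ(σ_b σp)Σ(σ_c σp) ≤ 0`: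
GHS (`ghs_gksSum`) for the tilted couplings with `tanh κ = t ∈ (0,1)`, expanded through `ghsPivot_sum`
and the vanishing of the odd zero-field sums, then `t → 1⁻`. -/
theorem ghsPivot_gksSum_le {Λ : Finset V} {β : ℝ} (hβ : 0 ≤ β) {p : V} (hp : p ∈ Λ) (a b c : ↥Λ) :
    gksSum (isingIdx G Λ) (gksCoupling G Λ β 0 .free) (isingSupp Λ) (fun _ => 1) ^ 2 *
          gksSum (isingIdx G Λ) (gksCoupling G Λ β 0 .free) (isingSupp Λ)
            (fun τ => spinAt a τ * spinAt b τ * spinAt c τ * spinAt p (glue Λ τ .free)) -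
        gksSum (isingIdx G Λ) (gksCoupling G Λ β 0 .free) (isingSupp Λ) (fun _ => 1) *
          (gksSum (isingIdx G Λ) (gksCoupling G Λ β 0 .free) (isingSupp Λ) (fun τ => spinAt a τ * spinAt b τ) *
              gksSum (isingIdx G Λ) (gksCoupling G Λ β 0 .free) (isingSupp Λ)
                (fun τ => spinAt c τ * spinAt p (glue Λ τ .free)) +
            gksSum (isingIdx G Λ) (gksCoupling G Λ β 0 .free) (isingSupp Λ) (fun τ => spinAt a τ * spinAt c τ) *
              gksSum (isingIdx G Λ) (gksCoupling G Λ β 0 .free) (isingSupp Λ)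
                (fun τ => spinAt b τ * spinAt p (glue Λ τ .free)) +
            gksSum (isingIdx G Λ) (gksCoupling G Λ β 0 .free) (isingSupp Λ) (fun τ => spinAt b τ * spinAt c τ) *
              gksSum (isingIdx G Λ) (gksCoupling G Λ β 0 .free) (isingSupp Λ)
                (fun τ => spinAt a τ * spinAt p (glue Λ τ .free))) +
        2 * (gksSum (isingIdx G Λ) (gksCoupling G Λ β 0 .free) (isingSupp Λ)
              (fun τ => spinAt a τ * spinAt p (glue Λ τ .free)) *
            gksSum (isingIdx G Λ) (gksCoupling G Λ β 0 .free) (isingSupp Λ)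
              (fun τ => spinAt b τ * spinAt p (glue Λ τ .free)) *
            gksSum (isingIdx G Λ) (gksCoupling G Λ β 0 .free) (isingSupp Λ)
              (fun τ => spinAt c τ * spinAt p (glue Λ τ .free))) ≤ 0 := by
  -- spins flip sign under `τ ↦ -τ`
  have hflipΛ : ∀ (x : ↥Λ) (τ : SpinConfig ↥Λ), spinAt x (-τ) = -spinAt x τ := by
    intro x τ; simp [spinAt, Units.val_neg]
  have hflipp : ∀ τ : SpinConfig ↥Λ, spinAt p (glue Λ (-τ) .free) = -spinAt p (glue Λ τ .free) :=
    fun τ => by simpa using spinAt_glue_neg_flip_of_mem Λ τ .free hp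
  -- odd zero-field sums vanish
  have h1 : gksSum (isingIdx G Λ) (gksCoupling G Λ β 0 .free) (isingSupp Λ)
      (fun τ => (1:ℝ) * spinAt p (glue Λ τ .free)) = 0 :=
    ghsPivot_sum_eq_zero_of_odd G Λ β _ fun τ => by rw [hflipp]; ring
  have h3 : gksSum (isingIdx G Λ) (gksCoupling G Λ β 0 .free) (isingSupp Λ)
      (fun τ => spinAt a τ * spinAt b τ * spinAt c τ) = 0 :=
    ghsPivot_sum_eq_zero_of_odd G Λ β _ fun τ => by rw [hflipΛ, hflipΛ, hflipΛ]; ring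
  have h3p : ∀ x y : ↥Λ, gksSum (isingIdx G Λ) (gksCoupling G Λ β 0 .free) (isingSupp Λ)
      (fun τ => spinAt x τ * spinAt y τ * spinAt p (glue Λ τ .free)) = 0 := fun x y =>
    ghsPivot_sum_eq_zero_of_odd G Λ β _ fun τ => by rw [hflipΛ, hflipΛ, hflipp]; ring
  have h1x : ∀ x : ↥Λ, gksSum (isingIdx G Λ) (gksCoupling G Λ β 0 .free) (isingSupp Λ)
      (fun τ => spinAt x τ) = 0 := fun x =>
    ghsPivot_sum_eq_zero_of_odd G Λ β _ fun τ => by rw [hflipΛ]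
  -- abbreviations
  set Z := gksSum (isingIdx G Λ) (gksCoupling G Λ β 0 .free) (isingSupp Λ) (fun _ => 1) with hZ
  set Q := gksSum (isingIdx G Λ) (gksCoupling G Λ β 0 .free) (isingSupp Λ)
    (fun τ => spinAt a τ * spinAt b τ * spinAt c τ * spinAt p (glue Λ τ .free)) with hQ
  set Sab := gksSum (isingIdx G Λ) (gksCoupling G Λ β 0 .free) (isingSupp Λ) (fun τ => spinAt a τ * spinAt b τ)
  set Sac := gksSum (isingIdx G Λ) (gksCoupling G Λ β 0 .free) (isingSupp Λ) (fun τ => spinAt a τ * spinAt c τ)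
  set Sbc := gksSum (isingIdx G Λ) (gksCoupling G Λ β 0 .free) (isingSupp Λ) (fun τ => spinAt b τ * spinAt c τ)
  set Sap := gksSum (isingIdx G Λ) (gksCoupling G Λ β 0 .free) (isingSupp Λ)
    (fun τ => spinAt a τ * spinAt p (glue Λ τ .free))
  set Sbp := gksSum (isingIdx G Λ) (gksCoupling G Λ β 0 .free) (isingSupp Λ)
    (fun τ => spinAt b τ * spinAt p (glue Λ τ .free))
  set Scp := gksSum (isingIdx G Λ) (gksCoupling G Λ β 0 .free) (isingSupp Λ)
    (fun τ => spinAt c τ * spinAt p (glue Λ τ .free))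
  set A := Z ^ 2 * Q - Z * (Sab * Scp + Sac * Sbp + Sbc * Sap) with hA
  set Pp := Sap * Sbp * Scp with hPp
  -- `A + 2 t² Pp ≤ 0` for every `t ∈ (0,1)`, from GHS in the tilted system with `tanh κ = t`
  have key : ∀ t ∈ Set.Ioo (0:ℝ) 1, A + 2 * t ^ 2 * Pp ≤ 0 := by
    intro t ht
    set κ := Real.artanh t with hκ
    have hth : Real.tanh κ = t := Real.tanh_artanh ⟨by linarith [ht.1], ht.2⟩
    have hch : 0 < Real.cosh κ := Real.cosh_pos κ
    have hsh : 0 < Real.sinh κ := by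
      have h0 := Real.tanh_eq_sinh_div_cosh κ
      rw [hth] at h0
      have h1 : Real.sinh κ = t * Real.cosh κ := by
        field_simp at h0
        linarith
      rw [h1]; exact mul_pos ht.1 hch
    have hκ0 : 0 ≤ κ := not_lt.mp fun hneg => absurd (Real.sinh_neg_iff.mpr hneg) (not_lt.mpr hsh.le)
    -- GHS for the tilted couplings, rewritten through `ghsPivot_sum` and the vanishing odd sums
    have hG := ghs_gksSum (isingIdx G Λ)
      (Sum.elim (fun e => gksCoupling G Λ β 0 .free (.inl e)) (fun x => if x = p then κ else 0))
      (isingSupp Λ) (ghsPivot_coupling_nonneg G hβ hκ0 p) (fun i _ => card_isingSupp_le_two Λ i) a b c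
    simp only [ghsPivot_sum G Λ β κ hp] at hG
    rw [h3, h1, h1x a, h1x b, h1x c, h3p a b, h3p a c, h3p b c] at hG
    simp only [mul_zero, zero_add, add_zero] at hG
    have hfac : (Real.cosh κ * Z) ^ 2 * (Real.sinh κ * Q) -
        Real.cosh κ * Z * (Real.cosh κ * Sab * (Real.sinh κ * Scp) + Real.cosh κ * Sac * (Real.sinh κ * Sbp) +
          Real.cosh κ * Sbc * (Real.sinh κ * Sap)) +
        2 * (Real.sinh κ * Sap * (Real.sinh κ * Sbp) * (Real.sinh κ * Scp)) =
        Real.cosh κ ^ 2 * Real.sinh κ * (A + 2 * (Real.sinh κ / Real.cosh κ) ^ 2 * Pp) := by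
      rw [hA, hPp]; field_simp
    have hG' : Real.cosh κ ^ 2 * Real.sinh κ * (A + 2 * (Real.sinh κ / Real.cosh κ) ^ 2 * Pp) ≤ 0 := by
      rw [← hfac]; linarith [hG]
    have hpos : 0 < Real.cosh κ ^ 2 * Real.sinh κ := by positivity
    have hle : A + 2 * (Real.sinh κ / Real.cosh κ) ^ 2 * Pp ≤ 0 :=
      not_lt.mp fun hcon => absurd (mul_pos hpos hcon) (not_lt.mpr hG')
    rwa [← Real.tanh_eq_sinh_div_cosh, hth] at hle
  -- let `t → 1⁻`
  have hcont : Continuous fun t : ℝ => A + 2 * t ^ 2 * Pp := by continuity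
  have ht : Tendsto (fun t : ℝ => A + 2 * t ^ 2 * Pp) (𝓝[<] 1) (𝓝 (A + 2 * 1 ^ 2 * Pp)) :=
    (hcont.tendsto 1).mono_left nhdsWithin_le_nhds
  have hev : ∀ᶠ t in 𝓝[<] (1:ℝ), A + 2 * t ^ 2 * Pp ≤ 0 := by
    filter_upwards [Ioo_mem_nhdsLT (zero_lt_one' ℝ)] with t ht' using key t ht'
  have hlim := le_of_tendsto ht hev
  simp only [one_pow, mul_one] at hlim
  rw [hA, hPp] at hlim
  linarith

/-- **GHS with a pivot spin, free box, zero field.** For `β ≥ 0` and `p a b c ∈ Λ`,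
`⟨σ_pσ_aσ_bσ_c⟩ ≤ ⟨σ_pσ_a⟩⟨σ_bσ_c⟩ + ⟨σ_pσ_b⟩⟨σ_aσ_c⟩ + ⟨σ_pσ_c⟩⟨σ_aσ_b⟩ - 2⟨σ_pσ_a⟩⟨σ_pσ_b⟩⟨σ_pσ_c⟩`,
i.e. `U₄(p,a,b,c) ≤ -2 G_pa G_pb G_pc` — GHS in the system pinned at `p` (Lebowitz 1974, eq. (1.8), in the
ensemble conditioned on `σ_p = +1`). Normalised form of `ghsPivot_gksSum_le`. -/
theorem ghsPivot_free_le {Λ : Finset V} {β : ℝ} (hβ : 0 ≤ β) {p a b c : V} (hp : p ∈ Λ) (ha : a ∈ Λ)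
    (hb : b ∈ Λ) (hc : c ∈ Λ) :
    isingExpect G Λ β 0 .free (spinMonomial ![p, a, b, c]) ≤
      isingTwoPoint G Λ β 0 .free p a * isingTwoPoint G Λ β 0 .free b c +
        isingTwoPoint G Λ β 0 .free p b * isingTwoPoint G Λ β 0 .free a c +
        isingTwoPoint G Λ β 0 .free p c * isingTwoPoint G Λ β 0 .free a b -
      2 * (isingTwoPoint G Λ β 0 .free p a * isingTwoPoint G Λ β 0 .free p b *
        isingTwoPoint G Λ β 0 .free p c) := by
  have h := ghsPivot_gksSum_le G hβ hp ⟨a, ha⟩ ⟨b, hb⟩ ⟨c, hc⟩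
  simp only [spinAt_glue_of_mem _ _ hp] at h
  -- rewrite the seven expectations as ratios of zero-field sums
  have m4 : Measurable (spinMonomial (V := V) ![p, a, b, c]) := measurable_spinMonomial _
  have mpr : ∀ x y : V, Measurable (spinPair (V := V) x y) := fun x y =>
    (measurable_spinAt x).mul (measurable_spinAt y)
  simp only [isingTwoPoint]
  rw [isingExpect_eq_gksSum_div G Λ β 0 .free m4, isingExpect_eq_gksSum_div G Λ β 0 .free (mpr p a),
    isingExpect_eq_gksSum_div G Λ β 0 .free (mpr b c), isingExpect_eq_gksSum_div G Λ β 0 .free (mpr p b),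
    isingExpect_eq_gksSum_div G Λ β 0 .free (mpr a c), isingExpect_eq_gksSum_div G Λ β 0 .free (mpr p c),
    isingExpect_eq_gksSum_div G Λ β 0 .free (mpr a b)]
  simp only [spinMonomial, spinPair, Fin.prod_univ_four, Fin.isValue, Matrix.cons_val_zero, Matrix.cons_val_one,
    Matrix.cons_val, spinAt_glue_of_mem _ _ hp, spinAt_glue_of_mem _ _ ha, spinAt_glue_of_mem _ _ hb,
    spinAt_glue_of_mem _ _ hc]
  -- normalise the order of the factors inside the integrands to match `h`
  have e4 : (fun τ : SpinConfig ↥Λ => spinAt (⟨p, hp⟩ : ↥Λ) τ * spinAt (⟨a, ha⟩ : ↥Λ) τ *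
      spinAt (⟨b, hb⟩ : ↥Λ) τ * spinAt (⟨c, hc⟩ : ↥Λ) τ) =
      fun τ => spinAt (⟨a, ha⟩ : ↥Λ) τ * spinAt (⟨b, hb⟩ : ↥Λ) τ * spinAt (⟨c, hc⟩ : ↥Λ) τ *
        spinAt (⟨p, hp⟩ : ↥Λ) τ := by funext τ; ring
  have e2 : ∀ x : ↥Λ, (fun τ : SpinConfig ↥Λ => spinAt (⟨p, hp⟩ : ↥Λ) τ * spinAt x τ) =
      fun τ => spinAt x τ * spinAt (⟨p, hp⟩ : ↥Λ) τ := fun x => by funext τ; ring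
  rw [e4, e2 ⟨a, ha⟩, e2 ⟨b, hb⟩, e2 ⟨c, hc⟩]
  set Z := gksSum (isingIdx G Λ) (gksCoupling G Λ β 0 .free) (isingSupp Λ) (fun _ => 1) with hZdef
  have hZ : 0 < Z := gksSum_one_pos _ _ _
  set Q := gksSum (isingIdx G Λ) (gksCoupling G Λ β 0 .free) (isingSupp Λ)
    (fun τ => spinAt (⟨a, ha⟩ : ↥Λ) τ * spinAt (⟨b, hb⟩ : ↥Λ) τ * spinAt (⟨c, hc⟩ : ↥Λ) τ * spinAt (⟨p, hp⟩ : ↥Λ) τ)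
  set Sab := gksSum (isingIdx G Λ) (gksCoupling G Λ β 0 .free) (isingSupp Λ)
    (fun τ => spinAt (⟨a, ha⟩ : ↥Λ) τ * spinAt (⟨b, hb⟩ : ↥Λ) τ)
  set Sac := gksSum (isingIdx G Λ) (gksCoupling G Λ β 0 .free) (isingSupp Λ)
    (fun τ => spinAt (⟨a, ha⟩ : ↥Λ) τ * spinAt (⟨c, hc⟩ : ↥Λ) τ)
  set Sbc := gksSum (isingIdx G Λ) (gksCoupling G Λ β 0 .free) (isingSupp Λ)
    (fun τ => spinAt (⟨b, hb⟩ : ↥Λ) τ * spinAt (⟨c, hc⟩ : ↥Λ) τ)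
  set Sap := gksSum (isingIdx G Λ) (gksCoupling G Λ β 0 .free) (isingSupp Λ)
    (fun τ => spinAt (⟨a, ha⟩ : ↥Λ) τ * spinAt (⟨p, hp⟩ : ↥Λ) τ)
  set Sbp := gksSum (isingIdx G Λ) (gksCoupling G Λ β 0 .free) (isingSupp Λ)
    (fun τ => spinAt (⟨b, hb⟩ : ↥Λ) τ * spinAt (⟨p, hp⟩ : ↥Λ) τ)
  set Scp := gksSum (isingIdx G Λ) (gksCoupling G Λ β 0 .free) (isingSupp Λ)
    (fun τ => spinAt (⟨c, hc⟩ : ↥Λ) τ * spinAt (⟨p, hp⟩ : ↥Λ) τ)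
  rw [← sub_nonpos]
  have hrew : Q / Z - (Sap / Z * (Sbc / Z) + Sbp / Z * (Sac / Z) + Scp / Z * (Sab / Z) -
      2 * (Sap / Z * (Sbp / Z) * (Scp / Z))) =
      (Z ^ 2 * Q - Z * (Sab * Scp + Sac * Sbp + Sbc * Sap) + 2 * (Sap * Sbp * Scp)) / Z ^ 3 := by
    field_simp
    ring
  rw [hrew]
  exact div_nonpos_of_nonpos_of_nonneg h (by positivity)

end GHSPivot

/-! ### Part B — the registered stub: the GHS pivot floor for the critical state on `ℤ³` -/

/-- **Stub 8 (`stub_ghsPivot`, GHS with a pivot spin, critical state on `ℤ³`).** For all sites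
`p x y z : ℤ³`, `S₄(p,x,y,z) ≤ G_px G_yz + G_py G_xz + G_pz G_xy − 2·G_px G_py G_pz` for `criticalCorr 3`,
i.e. `U₄(p,x,y,z) ≤ −2 G_px G_py G_pz`: the Griffiths–Hurst–Sherman inequality of the system conditioned on
`σ_p = +1` (free boxes at `β_c`, field at `p` sent to `+∞`, then the box limit `criticalCorr_wellDefined_holds`).
Source: GHS 1970; Lebowitz 1974 eq. (1.8); Aizenman, *Geometric analysis of Ising models III* (2025) §11 eq. (GHS).
Proof: `GHSPivot.ghsPivot_free_le` in the free boxes `box 3 L` at `β_c(3)` (the four points lie in the box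
eventually, `exists_forall_subset_box`), and the seven correlations converge to their `criticalCorr 3` values
(`criticalCorr_wellDefined_holds`, free b.c.), so the closed inequality passes to the limit. -/
theorem stub_ghsPivot : ∀ p x y z : Site 3,
    criticalCorr 3 4 ![p, x, y, z] ≤
      criticalCorr 3 2 ![p, x] * criticalCorr 3 2 ![y, z] + criticalCorr 3 2 ![p, y] * criticalCorr 3 2 ![x, z] +
        criticalCorr 3 2 ![p, z] * criticalCorr 3 2 ![x, y] -
      2 * (criticalCorr 3 2 ![p, x] * criticalCorr 3 2 ![p, y] * criticalCorr 3 2 ![p, z]) := by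
  intro p x y z
  have hmem : (BoundaryCondition.free : BoundaryCondition (Site 3)) ∈
      ({.free, .plus, .minus} : Set (BoundaryCondition (Site 3))) := by simp
  have h4 : Tendsto (fun L : ℕ => isingExpect (zdGraph 3) (box 3 L) (criticalBeta 3) 0 .free
      (spinMonomial ![p, x, y, z])) atTop (𝓝 (criticalCorr 3 4 ![p, x, y, z])) :=
    criticalCorr_wellDefined_holds (d := 3) le_rfl 4 _ .free hmem
  have hT : ∀ u v : Site 3, Tendsto (fun L : ℕ => isingTwoPoint (zdGraph 3) (box 3 L)
      (criticalBeta 3) 0 .free u v) atTop (𝓝 (criticalCorr 3 2 ![u, v])) := by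
    intro u v
    refine Tendsto.congr (fun L => ?_) (criticalCorr_wellDefined_holds (d := 3) le_rfl 2 ![u, v] .free hmem)
    simp only [isingTwoPoint, spinMonomial_two]
  -- the four points lie in `box 3 L` eventually
  have hin : ∀ᶠ L : ℕ in atTop, ∀ i, (![p, x, y, z] : Fin 4 → Site 3) i ∈ box 3 L := by
    classical
    obtain ⟨L₀, hL₀⟩ := exists_forall_subset_box 3 (Finset.univ.image (![p, x, y, z] : Fin 4 → Site 3))
    filter_upwards [eventually_ge_atTop L₀] with L hL i
    exact hL₀ L hL (Finset.mem_image_of_mem _ (Finset.mem_univ i))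
  -- the finite-volume inequality, eventually in `L`
  have hev : ∀ᶠ L : ℕ in atTop,
      isingExpect (zdGraph 3) (box 3 L) (criticalBeta 3) 0 .free (spinMonomial ![p, x, y, z]) ≤
        isingTwoPoint (zdGraph 3) (box 3 L) (criticalBeta 3) 0 .free p x *
            isingTwoPoint (zdGraph 3) (box 3 L) (criticalBeta 3) 0 .free y z +
          isingTwoPoint (zdGraph 3) (box 3 L) (criticalBeta 3) 0 .free p y *
            isingTwoPoint (zdGraph 3) (box 3 L) (criticalBeta 3) 0 .free x z +
          isingTwoPoint (zdGraph 3) (box 3 L) (criticalBeta 3) 0 .free p z *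
            isingTwoPoint (zdGraph 3) (box 3 L) (criticalBeta 3) 0 .free x y -
        2 * (isingTwoPoint (zdGraph 3) (box 3 L) (criticalBeta 3) 0 .free p x *
            isingTwoPoint (zdGraph 3) (box 3 L) (criticalBeta 3) 0 .free p y *
          isingTwoPoint (zdGraph 3) (box 3 L) (criticalBeta 3) 0 .free p z) := by
    filter_upwards [hin] with L hL
    exact GHSPivot.ghsPivot_free_le (zdGraph 3) (criticalBeta_nonneg 3)
      (by simpa using hL 0) (by simpa using hL 1) (by simpa using hL 2) (by simpa using hL 3)
  exact le_of_tendsto_of_tendsto h4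
    (((((hT p x).mul (hT y z)).add ((hT p y).mul (hT x z))).add ((hT p z).mul (hT x y))).sub
      ((((hT p x).mul (hT p y)).mul (hT p z)).const_mul 2)) hev

end Summit.CriticalPhenomena.Ising3DConformalLimit.Cruxes.Interlacing.Sketch

end
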